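import Literature.NumberTheory.EllipticCurves.Wuthrich2014.SurjectiveDivisibilityCyclotomicThreeMinus
import HarnessLib

/-!
# Kato's divisibility at `p = 3` under surjective `ρ_{E,3^∞}`, the `ω`-COMPONENT — CLAUSE FORM,
# DERIVED from the tree's named fact
# `Wuthrich2014.kato_minusEigenCharIdeal_dvd_cyclotomicThree_of_surjective` (NO named fact here)

Sources, as PUBLISHED. Good ordinary `3`: K. Kato, Astérisque 295 (2004) [Kato2004Asterisque]
(held copy `paper:doi-10-24033-ast-639`, PDF page `p0158` = p. 273, L27–L40), **Theorem 17.4**: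
"Assume `f` has good ordinary reduction at `λ`. Let `T` be a `Gal(ℚ̄/ℚ)`-stable `O_λ`-lattice of
`V_{F_λ}(f)`. (1) `X(T)` is a torsion `Λ`-module. […] (3) […] assume that both `ω` and `γ` are good
[…]. Assume further `p ≠ 2` and that the condition 12.5.2 in 12.5 (4) is satisfied. Then
`L_{p-adic,α,ω,γ}(f)` belongs to `Λ` and `length_{Λ_𝔭}(X(T)_𝔭) ≤ ord_𝔭(L_{p-adic,α,ω,γ}(f))` for
any prime ideal `𝔭` of `Λ` of height one" (`Λ = O_λ⟦Gal(ℚ(ζ_{p^∞})/ℚ)⟧`, §17.3; (12.5.2), p. 222,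
`p0107` L16–L20: "the image of `Gal(ℚ̄/ℚ(ζ_{p^∞})) → GL₂(O_λ)` contains `SL₂(ℤ_p)`"; §17.5, p. 274).
Multiplicative `3`: C. Wuthrich, Doc. Math. 19 (2014) [Wuthrich2014] (held copy
`paper:doi-10-4171-dm-450`), §1 Thm. 3 with its attribution sentence (p. 383, `p0002` L21–L25:
"We formulate it here for the full cyclotomic `ℤ_p^×`-extension. […] This theorem was proven by
Kato in the case that the representation on the Tate module was surjective") and Cor. 19 with the
first case of its proof (pp. 398–399, `p0014` L7: "`char_Λ X(E)`, or `I char_Λ X(E)` in the split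
multiplicative case, divides the ideal generated by `L_p(E)`. Proof. […] in the first case the
representation `ρ_p : G_ℚ → Aut(T_pE)` is surjective"); §3 (p. 390, `M = ⊕ M_i`); §3.2 (p. 394);
§5 (p. 397); Cor. 18 (p. 398).

HISTORY / STATUS (cell `b2b-bsdres`, KERNEL-C-P3 brick 4, big-image twin). The `ω`-component of
Kato's divisibility at `p = 3` for curves with `ρ_{E,3^∞}` onto — `char_{Λ(Γ)}(e₁X(E/ℚ(ζ_{3^∞}))) ∋
u · L₃(E, ω¹, T)` in the Literature eigen-Selmer vocabulary — is the tree's NAMED FACT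
`Wuthrich2014.kato_minusEigenCharIdeal_dvd_cyclotomicThree_of_surjective`
(`Wuthrich2014/SurjectiveDivisibilityCyclotomicThreeMinus.lean`, p233255, filed by the consumer
sub-cell additive-p1). THIS module, which briefly carried an independently written duplicate
transcription (p233545 by the literature seat), now holds NO named fact: it re-packages the
canonical fact in CLAUSE FORM — `ε` any integer-valued function that is `+1` on `Gal(ℚ̄/K)` and
`−1` off it, and one conclusion per local type at `3` instead of a disjunction over the odd branch
`Lminus`. Two lines of logic; a kernel CONSISTENCY CHECK between the transcriptions; 0 new facts
(D-0026).

The reading (verbatim that of the canonical fact and of the product readings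
`Kato2004.charIdeal_dvd_padicLFunction_cyclotomicThree_of_surjective` p216633, flag
`Kato-17.4-p3-branch-split`; `Wuthrich2014.kato_charIdeal_dvd_[non]splitMultiplicative_cyclotomicThree_of_surjective`,
flags `Wu14-surj-attribution`, `Wu14-Thm16-p3-branch-split`): `Λ(G_∞) = Λ(Γ)e₀ ⊕ Λ(Γ)e₁`
(`Δ = {±1}`, `ω¹ = χ_K`, `K = ℚ(ζ₃)`); the height-one primes of `Λ(G_∞)` are those of the two
factors, so the printed statements are the pair `char_{Λ(Γ)}(e_iX) ∣ e_iL`; `e₁X` = the dual of the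
`ω`-eigenspace of `Sel_{3^∞}(E/ℚ(ζ_{3^∞}))` = any
`D : EigenSelmerDualData E 3 (ker κ ⊓ galRange K) (ker κ) ε γ` (`κ` cyclotomic, `γ ∈ Gal(ℚ̄/K)`,
`χ₃(γ)·ζ = 4` so `ζ = 1`, `T = γ_* − 1` the tree's variable); `e₁L = L₃(E,ω¹,T)` on the minus
symbols (Kato Thm. 16.2 with good `ω, γ`; MTT §I.13), `= u·ϖ'·padicLFunctionMinusBranch f (unitRoot E 3) 1`
(good ordinary) resp. `u·ϖ'·padicLFunctionMinusBranchMult f (±1) 1` (split / non-split),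
`ϖ'·|Ω⁻(E)| = Ω⁻_f`, `u ∈ ℤ₃ˣ`; `e₁I = e₁Λ` (no factor in the split clause). Image hypothesis spelled
`∀ n, HasSurjectiveModNGaloisRep (3^n)` (implies (12.5.2): `det ρ = χ₃` cuts out `ℚ(ζ_{3^∞})`).

HONEST FRAMING (cell `b2b-bsdres`): published theorems read componentwise; the cell's class labels
are unchanged by this file; nothing here is "finishing BSD".
-/

set_option autoImplicit false

noncomputable section

open scoped Classical MatrixGroups ModularForm

open CongruenceSubgroup WeierstrassCurve Literature.NumberTheory.EllipticCurves
  Literature.NumberTheory.EllipticCurves.ModularForms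
  Literature.NumberTheory.GaloisRepresentations

namespace Literature.NumberTheory.EllipticCurves.Kato2004

/-- **Kato's divisibility at `p = 3` under `ρ_{E,3^∞}` onto, `ω`-component — clause form, DERIVED
from the named fact `Wuthrich2014.kato_minusEigenCharIdeal_dvd_cyclotomicThree_of_surjective`.**
As printed — good ordinary `3`: Kato, Astérisque 295 (2004) Thm. 17.4 (p. 273): "Assume `f` has
good ordinary reduction at `λ`. […] (1) `X(T)` is a torsion `Λ`-module. […] (3) […] Assume further
`p ≠ 2` and that the condition 12.5.2 in 12.5 (4) is satisfied. Then `L_{p-adic,α,ω,γ}(f)` belongs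
to `Λ` and `length_{Λ_𝔭}(X(T)_𝔭) ≤ ord_𝔭(L_{p-adic,α,ω,γ}(f))` for any prime ideal `𝔭` of `Λ` of
height one"; multiplicative `3`: Wuthrich, Doc. Math. 19 (2014) Thm. 3 with its attribution
sentence (p. 383: "proven by Kato in the case that the representation on the Tate module was
surjective") and Cor. 19 with the first case of its proof (pp. 398–399); read on the
`ω`-eigencomponent at `p = 3` (Wuthrich §3 p. 390 "`M = ⊕ M_i`"): for `V` globally minimal with
`ρ̄_{V,3^n}` onto for all `n`, `K = ℚ(ζ₃)` (`galRange K` normal), `κ` cyclotomic with topological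
generator `γ ∈ galRange K` matching the cyclotomic variable, `ε = χ_K` as a sign (ANY `ε` equal to
`1` on `galRange K` and `−1` off it), `f` the newform of `V`, `D` any dual datum of the
`ω`-eigen-Selmer group, `ϖ'·|Ω⁻(V)| = Ω⁻_f`: in each local type at `3` — good ordinary
(`α = unitRoot V 3`), split (`α = 1`), non-split multiplicative (`α = −1`) — `D.X` is `Λ`-torsion and
`ι g = C(u ϖ')·L⁻₃(f, α, ω¹, T)` for some `g ∈ char_Λ D.X`, `u ∈ ℤ₃ˣ`. Proof: specialise the
canonical fact's disjunction over `Lminus` to each branch. No new assertion (0 debt); flag families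
`Kato-17.4-p3-branch-split`, `Wu14-surj-attribution`.
[cite: Kato2004Asterisque, Thm. 17.4 (1)(3) (p. 273) with §17.3 (p. 273), Thm. 12.5 (4) (12.5.2) (p. 222), §17.5 (p. 274)]
[cite: Wuthrich2014, Thm. 3 and §1 (p. 383), Cor. 19 and its proof (pp. 398–399), §3 (p. 390), §3.2 (p. 394), §5 (p. 397)]
[cite: MazurTateTeitelbaum1986Invent, §I.10, §I.13] -/
theorem charIdeal_minusComponent_dvd_padicLFunction_cyclotomicThree_of_surjective_of_kato
    (h : Wuthrich2014.kato_minusEigenCharIdeal_dvd_cyclotomicThree_of_surjective) :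
    ∀ (V : WeierstrassCurve ℚ) [V.IsElliptic] [V.IsGloballyMinimal]
      (K : Type) [Field K] [NumberField K] [IsCyclotomicExtension {3} ℚ K]
      [(galRange (K := ℚ) K).Normal]
      {κ : ZpExtension ℚ 3} {γ : Field.absoluteGaloisGroup ℚ} {ε : Field.absoluteGaloisGroup ℚ → ℤ}
      {N : ℕ} [NeZero N] {f : CuspForm (Gamma0 N) 2},
      (∀ n : ℕ, V.HasSurjectiveModNGaloisRep (3 ^ n : ℕ)) →
      κ.IsCyclotomic → κ.IsTopGenerator γ → IsCyclotomicVariable 3 γ → γ ∈ galRange (K := ℚ) K →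
      (∀ g, g ∈ galRange (K := ℚ) K → ε g = 1) → (∀ g, g ∉ galRange (K := ℚ) K → ε g = -1) →
      IsNewformOf V f →
      ∀ (D : V.EigenSelmerDualData 3 (κ.kerSubgroup ⊓ galRange (K := ℚ) K) κ.kerSubgroup ε γ)
        (ϖ' : ℚ), (ϖ' : ℝ) * V.imaginaryPeriodRat = minusPeriod f →
        -- good ordinary `3` (Kato Thm. 17.4 (1)(3)): two-term measure, `α = unitRoot V 3`
        (IsOrdinaryAt V 3 →
          Module.IsTorsion (IwasawaAlgebra 3) D.X ∧
          ∃ g ∈ D.charIdeal, ∃ u : ℤ_[3]ˣ,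
            iwasawaToPowerSeries 3 g =
              PowerSeries.C (((u : ℤ_[3]) : ℚ_[3]) * (ϖ' : ℚ_[3])) *
                padicLFunctionMinusBranch f ((unitRoot V 3 : ℤ_[3]) : ℚ_[3]) 1) ∧
        -- split multiplicative `3` (Wuthrich Thm. 3 attribution / Cor. 19): `α = 1`; `e₁I = e₁Λ`
        (V.HasSplitMultiplicativeReductionAtPrime 3 →
          Module.IsTorsion (IwasawaAlgebra 3) D.X ∧
          ∃ g ∈ D.charIdeal, ∃ u : ℤ_[3]ˣ,
            iwasawaToPowerSeries 3 g =
              PowerSeries.C (((u : ℤ_[3]) : ℚ_[3]) * (ϖ' : ℚ_[3])) *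
                padicLFunctionMinusBranchMult f (1 : ℚ_[3]) 1) ∧
        -- non-split multiplicative `3` (Wuthrich Thm. 3 attribution / Cor. 19): `α = −1`
        (V.HasMultiplicativeReductionAtPrime 3 → ¬ V.HasSplitMultiplicativeReductionAtPrime 3 →
          Module.IsTorsion (IwasawaAlgebra 3) D.X ∧
          ∃ g ∈ D.charIdeal, ∃ u : ℤ_[3]ˣ,
            iwasawaToPowerSeries 3 g =
              PowerSeries.C (((u : ℤ_[3]) : ℚ_[3]) * (ϖ' : ℚ_[3])) *
                padicLFunctionMinusBranchMult f (-1 : ℚ_[3]) 1) := by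
  intro V _ _ K _ _ _ _ κ γ ε N _ f hsurj hκ hγ hcyc hγK hε₁ hε₂ hf D ϖ' hϖ'
  obtain rfl : ε = fun g ↦ if g ∈ galRange (K := ℚ) K then 1 else -1 := by
    funext g
    split_ifs with hg
    exacts [hε₁ g hg, hε₂ g hg]
  exact ⟨fun hord ↦ h V K _ (Or.inl ⟨hord, rfl⟩) hsurj hκ hγ hcyc hγK hf D ϖ' hϖ',
    fun hsplit ↦ h V K _ (Or.inr (Or.inl ⟨hsplit, rfl⟩)) hsurj hκ hγ hcyc hγK hf D ϖ' hϖ',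
    fun hmult hns ↦ h V K _ (Or.inr (Or.inr ⟨hmult, hns, rfl⟩)) hsurj hκ hγ hcyc hγK hf D ϖ' hϖ'⟩

end Literature.NumberTheory.EllipticCurves.Kato2004

end
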